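import Summits.CriticalPhenomena.PercolationContinuityZ3.Theorems.PercNearOneGluingNoHeavyLowerTailCovTauStarBridge
import Summits.CriticalPhenomena.PercolationContinuityZ3.Theorems.PercNearOneGluingNoHeavyLowerTailCovTauA2EdgeDefs
import HarnessLib

/-!
# The one-source bounds (★) and `Y ≤ B` for EDGE-cluster functionals
# (`CovTau.YfE / BfE` vocabulary)

Companion of `…CovTauStarBridge.lean` (vertex-cluster functionals `Ψ : Set V → ℝ`, `CovTau.Yf / Bf`).  edge-cluster
version of the two-source induction (`…CovTauA2EdgeDefs.lean` ff.: functionals `g : Set (Sym2 V) → ℝ` of van den Berg–Häggström–Kahn's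
open EDGE cluster `rC U x ω`, as in the final step `CovTau.covTau_of_diagonal`) needs the same two ONE-SOURCE bounds in
that vocabulary; here they are, derived from `CovTauStarN.starN_ED` / `CovTauStarN.yN_le_covOff` (which are natively about edge clusters)
through the dictionary of the companion file:
* `CovTauStarN.yfE_mul_mf_le` : `YfE w U x v g N * Mf w U x v ∅ ≤ Mf w U x v N * BfE w U x v g`   ((★_N));
* `CovTauStarN.yfE_le_bfE`    : `YfE w U x v g N ≤ BfE w U x v g`                                  (`Y ≤ B`, its corollary).
[cite: VandenbergHaggstromKahn2005, Thm. 1.1 (pp. 3–5), Thm. 1.4 (p. 7), eq. (6)] [cite: Gladkov2024, Thm. 3.2 (p. 4)]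
-/

noncomputable section

namespace Summit.CriticalPhenomena.PercolationContinuityZ3.Theorems

namespace CovTauStarN

open Finset MeasureTheory Literature.Probability.Percolation Literature.Probability.Percolation.DecisionTree
open Literature.Probability.Percolation.BHK2006 (weight edgesIn rC rD weight_nonneg)
open SetClusterExploration TreeHarris CovTau
open scoped Classical

variable {V : Type*} [Fintype V] [DecidableEq V]

omit [DecidableEq V] in
/-- `g (rC U x ↑K) = fcl g x K` for `K ⊆ pairsIn U`. [folklore] -/
theorem g_rC_eq_fcl {U : Finset V} (g : Set (Sym2 V) → ℝ) (x : V) {K : Finset (Sym2 V)} (hK : K ⊆ pairsIn U) :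
    g (rC U x (↑K : Set (Sym2 V))) = fcl g x K := by
  unfold fcl
  rw [show rC U x (↑K : Set (Sym2 V)) = openEdgeCluster ((↑K : Set (Sym2 V)) ∩ edgesIn U) x from rfl,
    coe_inter_edgesIn_of_subset hK]

/-- **`BfE` in the world `U ∖ W` is `covOff` on the coordinates `pairsIn U`.** [folklore] -/
theorem BfE_sdiff_eq_covOff (w : Sym2 V → ℝ) (U W : Finset V) (x v : V) (g : Set (Sym2 V) → ℝ) :
    BfE w (U \ W) x v g = covOff (pairsIn U) w g x v W := by
  have hsub : pairsIn (U \ W) ⊆ pairsIn U := by rw [pairsIn_sdiff]; exact off_subset W _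
  have hrC : ∀ (U' : Finset V) (ω : Set (Sym2 V)), rC U' x (ω ∩ edgesIn U') = rC U' x ω := fun U' ω => by
    show openEdgeCluster (ω ∩ edgesIn U' ∩ edgesIn U') x = openEdgeCluster (ω ∩ edgesIn U') x
    rw [Set.inter_assoc, Set.inter_self]
  have h1 : ∑ ω, weight w ω * (g (rC (U \ W) x ω) *
      ind {ω : Set (Sym2 V) | (openGraph (ω ∩ edgesIn (U \ W))).Reachable x v} ω) =
      ED (pairsIn (U \ W)) w (fun K => fcl g x K * hr x v K) := by
    rw [sum_weight_restrict w (U \ W) _ (fun ω => by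
      rw [hrC]
      congr 1
      refine BystanderBHK.ind_congr ?_
      simp only [Set.mem_setOf_eq, Set.inter_assoc, Set.inter_self])]
    exact ED_congr_on _ w fun K hK => by
      rw [g_rC_eq_fcl g x (Finset.mem_powerset.1 hK), ind_reach_eq_hr x v (Finset.mem_powerset.1 hK)]
  have h2 : tfE w (U \ W) x g = ED (pairsIn (U \ W)) w (fcl g x) := by
    unfold tfE
    rw [sum_weight_restrict w (U \ W) _ (fun ω => by rw [hrC])]
    exact ED_congr_on _ w fun K hK => g_rC_eq_fcl g x (Finset.mem_powerset.1 hK)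
  have h3 : cf w (U \ W) x v = ED (pairsIn (U \ W)) w (hr x v) := by
    unfold cf
    rw [sum_weight_restrict w (U \ W) _ (fun ω => by
      refine BystanderBHK.ind_congr ?_
      simp only [Set.mem_setOf_eq, Set.inter_assoc, Set.inter_self])]
    exact ED_congr_on _ w fun K hK => ind_reach_eq_hr x v (Finset.mem_powerset.1 hK)
  unfold BfE covOff
  rw [h1, h2, h3]
  have e1 : ED (pairsIn U) w (fun K => fcl g x (off W K) * hr x v (off W K)) =
      ED (pairsIn (U \ W)) w (fun K => fcl g x K * hr x v K) := by
    rw [← ED_inter_eq hsub w (fun K => fcl g x K * hr x v K)]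
    exact ED_congr_on _ w fun K hK => by rw [off_eq_inter W (Finset.mem_powerset.1 hK)]
  have e2 : ED (pairsIn U) w (fun K => fcl g x (off W K)) = ED (pairsIn (U \ W)) w (fcl g x) := by
    rw [← ED_inter_eq hsub w (fcl g x)]
    exact ED_congr_on _ w fun K hK => by rw [off_eq_inter W (Finset.mem_powerset.1 hK)]
  have e3 : ED (pairsIn U) w (fun K => hr x v (off W K)) = ED (pairsIn (U \ W)) w (hr x v) := by
    rw [← ED_inter_eq hsub w (hr x v)]
    exact ED_congr_on _ w fun K hK => by rw [off_eq_inter W (Finset.mem_powerset.1 hK)]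
  rw [e1, e2, e3]

/-- `BfE w U x v g = covOff (pairsIn U) w g x v ∅`. [folklore] -/
theorem BfE_eq_covOff (w : Sym2 V → ℝ) (U : Finset V) (x v : V) (g : Set (Sym2 V) → ℝ) :
    BfE w U x v g = covOff (pairsIn U) w g x v ∅ := by
  rw [← BfE_sdiff_eq_covOff, Finset.sdiff_empty]

/-- **`YfE = yN`** on the coordinates `pairsIn U`. [folklore] -/
theorem YfE_eq_yN (w : Sym2 V → ℝ) (U : Finset V) (x v : V) (g : Set (Sym2 V) → ℝ) (N : Set V) :
    YfE w U x v g N = yN (pairsIn U) w g x v (srcF N) := by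
  unfold YfE yN
  rw [sum_weight_restrict w U _ (fun ω => by
    have h1 : rest U N (ω ∩ edgesIn U) = rest U N ω := by simp only [rest, sC, Set.inter_assoc, Set.inter_self]
    have h2 : ind (rD U x N) (ω ∩ edgesIn U) = ind (rD U x N) ω :=
      BystanderBHK.ind_congr (by simp only [rD, Set.mem_setOf_eq, Set.inter_assoc, Set.inter_self])
    rw [h1, h2])]
  refine ED_congr_on _ w fun K hK => ?_
  have hK' := Finset.mem_powerset.1 hK
  rw [rest_eq_sdiff hK', BfE_sdiff_eq_covOff, ind_rD_eq x N hK', mul_comm]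

/-- **(★) in every world `G[U]`, edge vocabulary**: `YfE·Mf ∅ ≤ Mf N·BfE`. [cite: Gladkov2024, Thm. 3.2 (p. 4)]
[cite: VandenbergHaggstromKahn2005, Thm. 1.4 (p. 7), eq. (6) (p. 4)] -/
theorem yfE_mul_mf_le (w : Sym2 V → ℝ) (hw0 : ∀ e, 0 ≤ w e) (hw1 : ∀ e, w e ≤ 1) (x v : V) {g : Set (Sym2 V) → ℝ}
    (hg : Monotone g) (hg0 : ∀ C, 0 ≤ g C) (U : Finset V) (N : Set V) :
    YfE w U x v g N * Mf w U x v ∅ ≤ Mf w U x v N * BfE w U x v g := by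
  rw [YfE_eq_yN, Mf_empty_eq_ED, Mf_eq_ED, BfE_eq_covOff]
  exact starN_ED (pairsIn U) hw0 hw1 (srcF N) x v g hg hg0

/-- **`Y ≤ B` in every world `G[U]`, edge vocabulary.** [cite: Gladkov2024, Thm. 3.2 (p. 4)] -/
theorem yfE_le_bfE (w : Sym2 V → ℝ) (hw0 : ∀ e, 0 ≤ w e) (hw1 : ∀ e, w e ≤ 1) (x v : V) {g : Set (Sym2 V) → ℝ}
    (hg : Monotone g) (hg0 : ∀ C, 0 ≤ g C) (U : Finset V) (N : Set V) :
    YfE w U x v g N ≤ BfE w U x v g := by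
  rw [YfE_eq_yN, BfE_eq_covOff]
  exact yN_le_covOff (pairsIn U) hw0 hw1 (srcF N) x v g hg hg0

end CovTauStarN

end Summit.CriticalPhenomena.PercolationContinuityZ3.Theorems

end
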